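import Literature.NumberTheory.LFunctions.DedekindZetaTheta
import Mathlib.NumberTheory.NumberField.CanonicalEmbedding.NormLeOne
import Mathlib.NumberTheory.LSeries.AbstractFuncEq
import HarnessLib

/-!
# Hecke's coordinates, the theta integral `f(t)` and its weak FE-pair (Hecke's continuation of `ζ_K`, II)

Topic `Literature/NumberTheory/LFunctions`, continuing `DedekindZetaTheta.lean` towards the
discharge of Hecke's theorem `Literature.exists_isDedekindZetaContinuation K` (Neukirch, *Algebraic
Number Theory*, Ch. VII (5.11) (i)) along Neukirch's proof (VII (5.5)–(5.9)). Everything here is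
PROVED; the only input beyond Mathlib and `DedekindZetaTheta.lean` is the named fact
`Literature.NumberTheory.LFunctions.NumberField.thetaIdeal_inv` (VII (3.6)+(5.7), theta transformation), which enters through an
explicit hypothesis `(hinv : thetaIdeal_inv K)`.

Neukirch integrates `θ(𝔞, ixt^{1/n})` over a fundamental domain `F` of `|𝒪^*|²` in the norm-one
hypersurface `S` against a Haar measure `d*x` ((5.5)) and feeds `f_F(𝔞, t)` to the Mellin
principle (1.4). We realise `F × ℝ_+^*` in coordinates: with Mathlib's fundamental system of units
`u_1, …, u_{r-1}` (`NumberField.Units.fundSystem`), `n = [K:ℚ]`,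

* `heckeCoord K c t : InfinitePlace K → ℝ`, `y(c,t)_w = t^{1/n} ∏_i |u_i|_w^{2c_i}` (`c ∈ ℝ^{r-1}`,
  `t > 0`); `N(y(c,t)) = t` (`mixedNorm_heckeCoord`), `y(c, 1/t) = y(-c, t)⁻¹` (`heckeCoord_inv`, the
  substitution `x ↦ x⁻¹` of the proof of (5.8)), and the unit `ε_m = ∏ u_i^{m_i}` acts by
  `y(c + m, t) = |ε_m|² y(c,t)` (`heckeCoord_add_intCast`), i.e. by integer translation of `c`, so
  that `c ∈ [0,1]^{r-1}` is Neukirch's "fundamental mesh of `2 log|𝒪^*|`"; these coordinates are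
  Mathlib's `expMapBasis` (Roblot) at the parameters `(2c, (log t)/n)` (`expMapBasis_heckeParam`);
* `heckeFi K I ε t = ∫_{c ∈ [0,1]^{r-1}} θ_𝔞(i y(εc, t)) dc` — Neukirch's `f_F(𝔞, ·)` (`ε = 1`) and
  `f_{F⁻¹}(𝔞, ·)` (`ε = -1`) up to the normalisations `w⁻¹`, `d*x ↔ dc`, `t ↦ t/d_𝔞` (explicit
  constants only): it is `≥ 1`, antitone, continuous and locally integrable on `(0, ∞)`, and
  `f(t) - 1 = O(t^{-k/n})` for every `k > n/2` (`heckeFi_sub_one_le`, the polynomial form of the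
  second formula of (5.8)), from the decay `θ_𝔞(iy) - 1 = O(δ^{-k})` of `DedekindZetaTheta.lean`;
* `heckeFi_inv` — the first formula of (5.8), `f(1/t) = t^{1/2} (𝔑(𝔞)√|d_K|)⁻¹ g(t)` with
  `g = f_{(𝔞𝔡)⁻¹, -1}`, from `thetaIdeal_inv`;
* `heckePair hinv I hI : WeakFEPair ℂ` — the hypotheses of the Mellin principle (1.4), in Mathlib's
  form (`Mathlib.NumberTheory.LSeries.AbstractFuncEq`: weight `k = 1/2`, `ε = (𝔑(𝔞)√|d_K|)⁻¹`,
  `f₀ = g₀ = 1`); hence `(heckePair …).Λ`, the Mellin transform of `f - 1` for `Re s > 1/2`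
  (`WeakFEPair.hasMellin`), is meromorphic on `ℂ` with poles at most at `0, 1/2` — this is (5.9) for
  `L(f, s)` before the identification with `Z(𝔎, 2s)`;
* towards that identification ((5.3)–(5.5)): `fundUnit`, `coneDecompEquiv K I :
  {a ∈ 𝔞, a ≠ 0} ≃ conePoints K I × ℤ^{r-1}`, the decomposition `a = ε_m a'` of `𝔞 ∖ 0` along
  Mathlib's fundamental cone (`existsUnique_fundUnit_mul_mem_fundamentalCone`), which replaces
  Neukirch's system of representatives `ℜ` of `𝔞^*/𝒪^*` (each class is met `w` times in the cone).

Remaining for (5.11) (i) (kept in the session notes): the unfolding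
`L(f - 1, s) = C · π^{-ns} 4^{-r₂ s} Γ(s)^{r₁} Γ(2s)^{r₂} ∑_{a' ∈ cone ∩ 𝔞} |N a'|^{-2s}` ((5.5), via
`expMapBasis` and its Jacobian), the passage to ideal classes ((5.3), (5.4), Mathlib's
`idealSetEquivNorm`), and the sum over the class group ((5.10), (5.11)).

## References

* J. Neukirch, *Algebraic Number Theory*, Grundlehren 322, Springer 1999, Ch. VII §1 (1.4), §5
  (5.3)–(5.9), (5.11). [NeukirchANT1999]
* Mathlib: `NumberField.mixedEmbedding.fundamentalCone` (X. Roblot), `…CanonicalEmbedding.NormLeOne`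
  (`expMapBasis`), `NumberTheory.LSeries.AbstractFuncEq` (D. Loeffler, `WeakFEPair`).
-/


noncomputable section

open scoped NumberField nonZeroDivisors
open NumberField NumberField.InfinitePlace NumberField.Units MeasureTheory

namespace Literature.NumberTheory.LFunctions.NumberField

variable (K : Type*) [Field K] [NumberField K]

/-- Hecke's logarithmic coordinates on `R_+^* ≅ ℝ^{places}`:
`u(c, t)_w = (log t)/n + 2 ∑_i c_i log |u_i|_w`, where `u_1, …, u_{r-1}` is Mathlib's fundamental
system of units `fundSystem K`, `n = [K : ℚ]`. For `c` in a fundamental mesh of `ℤ^{r-1}` and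
`t > 0`, `exp ∘ u(c,t)` runs over Neukirch's cone `F · ℝ_+^*` over the fundamental domain `F ⊂ S`
(VII §5, before (5.5)), with `N = t`. [folklore] -/
def heckeLogCoord (c : Fin (rank K) → ℝ) (t : ℝ) (w : InfinitePlace K) : ℝ :=
  Real.log t / Module.finrank ℚ K + 2 * ∑ i, c i * Real.log (w (fundSystem K i : K))

/-- Hecke's coordinates `y(c, t)_w = t^{1/n} ∏_i |u_i|_w^{2 c_i} = exp (u(c,t)_w)` on `R_+^*`.
[folklore] -/
def heckeCoord (c : Fin (rank K) → ℝ) (t : ℝ) : InfinitePlace K → ℝ :=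
  fun w ↦ Real.exp (heckeLogCoord K c t w)

variable {K}

/-- `y(c,t)_w > 0`. [folklore] -/
theorem heckeCoord_pos (c : Fin (rank K) → ℝ) (t : ℝ) (w : InfinitePlace K) :
    0 < heckeCoord K c t w :=
  Real.exp_pos _

/-- The weighted sum of Hecke's logarithmic coordinates is `log t`:
`∑_w e_w u(c,t)_w = log t` (`∑_w e_w = n`, Mathlib `sum_mult_eq`; `∑_w e_w log |u|_w = 0` for a
unit `u`, Mathlib `Units.sum_mult_mul_log`). [folklore] -/
theorem sum_mult_mul_heckeLogCoord (c : Fin (rank K) → ℝ) (t : ℝ) :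
    ∑ w : InfinitePlace K, (mult w : ℝ) * heckeLogCoord K c t w = Real.log t := by
  simp only [heckeLogCoord, mul_add, Finset.sum_add_distrib, Finset.mul_sum]
  have hn : (Module.finrank ℚ K : ℝ) ≠ 0 := Nat.cast_ne_zero.mpr Module.finrank_pos.ne'
  have h1 : ∑ w : InfinitePlace K, (mult w : ℝ) * (Real.log t / Module.finrank ℚ K) = Real.log t := by
    rw [← Finset.sum_mul, ← Nat.cast_sum, sum_mult_eq, mul_div_cancel₀ _ hn]
  have h2 : ∑ w : InfinitePlace K, ∑ i, (mult w : ℝ) * (2 * (c i * Real.log (w (fundSystem K i : K))))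
      = 0 := by
    rw [Finset.sum_comm]
    refine Finset.sum_eq_zero fun i _ ↦ ?_
    have := sum_mult_mul_log (fundSystem K i)
    calc ∑ w : InfinitePlace K, (mult w : ℝ) * (2 * (c i * Real.log (w (fundSystem K i : K))))
        = 2 * c i * ∑ w : InfinitePlace K, (mult w : ℝ) * Real.log (w (fundSystem K i : K)) := by
          rw [Finset.mul_sum]; exact Finset.sum_congr rfl fun w _ ↦ by ring
      _ = 0 := by rw [this, mul_zero]
  rw [h1, h2, add_zero]

/-- `N(y(c,t)) = t` for `t > 0`: Hecke's coordinates at parameter `t` lie on the norm-`t`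
hypersurface (Neukirch VII §5: `N(x t^{1/n}) = t` for `x ∈ S`). [folklore] -/
theorem mixedNorm_heckeCoord (c : Fin (rank K) → ℝ) {t : ℝ} (ht : 0 < t) :
    mixedNorm K (heckeCoord K c t) = t := by
  simp only [mixedNorm, heckeCoord, ← Real.exp_nat_mul, ← Real.exp_sum]
  rw [sum_mult_mul_heckeLogCoord, Real.exp_log ht]

/-- Inversion: `u(c, t⁻¹) = -u(-c, t)`. [folklore] -/
theorem heckeLogCoord_inv (c : Fin (rank K) → ℝ) (t : ℝ) (w : InfinitePlace K) :
    heckeLogCoord K c t⁻¹ w = -heckeLogCoord K (-c) t w := by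
  simp only [heckeLogCoord, Real.log_inv, Pi.neg_apply, neg_mul, Finset.sum_neg_distrib,
    mul_neg, neg_add, neg_neg, neg_div]

/-- Inversion in Hecke's coordinates: `y(c, t⁻¹) = y(-c, t)⁻¹` (the substitution `x ↦ x⁻¹`,
`F ↦ F⁻¹` of the proof of Neukirch VII (5.8)). [folklore] -/
theorem heckeCoord_inv (c : Fin (rank K) → ℝ) (t : ℝ) :
    heckeCoord K c t⁻¹ = fun w ↦ (heckeCoord K (-c) t w)⁻¹ := by
  funext w
  simp only [heckeCoord, heckeLogCoord_inv, Real.exp_neg]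

/-- The unit `∏_i u_i^{m_i}` as an element of `K` is the product of the powers in `K`.
[folklore] -/
theorem coe_prod_fundSystem_zpow (m : Fin (rank K) → ℤ) :
    ((∏ i, fundSystem K i ^ m i : (𝓞 K)ˣ) : K) = ∏ i, (fundSystem K i : K) ^ m i := by
  have := map_prod ((algebraMap (𝓞 K) K : 𝓞 K →* K).comp (Units.coeHom (𝓞 K)))
    (fun i ↦ fundSystem K i ^ m i) Finset.univ
  simp only [MonoidHom.coe_comp, Function.comp_apply, Units.coeHom_apply, MonoidHom.coe_coe] at this
  refine this.trans (Finset.prod_congr rfl fun i _ ↦ ?_)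
  exact coe_zpow (fundSystem K i) (m i)

/-- `log |∏_i u_i^{m_i}|_w = ∑_i m_i log |u_i|_w`. [folklore] -/
theorem log_apply_prod_fundSystem_zpow (m : Fin (rank K) → ℤ) (w : InfinitePlace K) :
    Real.log (w ((∏ i, fundSystem K i ^ m i : (𝓞 K)ˣ) : K)) =
      ∑ i, (m i : ℝ) * Real.log (w (fundSystem K i : K)) := by
  rw [coe_prod_fundSystem_zpow, map_prod, Real.log_prod]
  · exact Finset.sum_congr rfl fun i _ ↦ by rw [map_zpow₀, Real.log_zpow]
  · exact fun i _ ↦ by rw [map_zpow₀]; exact (zpow_pos (pos_at_place _ w) _).ne'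

/-- Translation by the unit lattice: `y(c + m, t)_w = |∏_i u_i^{m_i}|_w² · y(c, t)_w` for
`m ∈ ℤ^{r-1}` (the action `x ↦ |ε|² x` of `𝒪^*` on `S`, Neukirch VII §5). [folklore] -/
theorem heckeCoord_add_intCast (c : Fin (rank K) → ℝ) (m : Fin (rank K) → ℤ) (t : ℝ)
    (w : InfinitePlace K) :
    heckeCoord K (c + fun i ↦ (m i : ℝ)) t w =
      w ((∏ i, fundSystem K i ^ m i : (𝓞 K)ˣ) : K) ^ 2 * heckeCoord K c t w := by
  have key : Real.exp (2 * ∑ i, (m i : ℝ) * Real.log (w (fundSystem K i : K))) =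
      w ((∏ i, fundSystem K i ^ m i : (𝓞 K)ˣ) : K) ^ 2 := by
    rw [← log_apply_prod_fundSystem_zpow,
      show (2 : ℝ) * Real.log (w ((∏ i, fundSystem K i ^ m i : (𝓞 K)ˣ) : K)) =
        Real.log (w ((∏ i, fundSystem K i ^ m i : (𝓞 K)ˣ) : K) ^ 2) by
          rw [Real.log_pow]; norm_num,
      Real.exp_log (pow_pos (pos_at_place _ w) 2)]
  simp only [heckeCoord, heckeLogCoord, Pi.add_apply, add_mul, Finset.sum_add_distrib, mul_add,
    Real.exp_add, key]
  ring

/-- The unit `ε = ∏_i u_i^{m_i}` rescales Neukirch's form exactly as the translation `c ↦ c + m`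
of Hecke's coordinates: `e_w y(c,t)_w |ε a|_w² = e_w y(c+m,t)_w |a|_w²` summed over `w`; this is
the identity `⟨aε x t', aε⟩ = ⟨a (|ε|²x) t', a⟩` in the proof of Neukirch VII (5.5). [folklore] -/
theorem sum_heckeCoord_unit_mul (c : Fin (rank K) → ℝ) (m : Fin (rank K) → ℤ) (t : ℝ) (a : K) :
    ∑ w : InfinitePlace K, (mult w : ℝ) * heckeCoord K c t w *
        w (((∏ i, fundSystem K i ^ m i : (𝓞 K)ˣ) : K) * a) ^ 2 =
      ∑ w : InfinitePlace K, (mult w : ℝ) * heckeCoord K (c + fun i ↦ (m i : ℝ)) t w * w a ^ 2 := by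
  refine Finset.sum_congr rfl fun w _ ↦ ?_
  rw [heckeCoord_add_intCast, map_mul, mul_pow]
  ring

/-! ### Hecke's coordinates are Mathlib's `expMapBasis` (Roblot) in the parameters `(2c, (log t)/n)`

Mathlib's `NumberField.mixedEmbedding.fundamentalCone.expMapBasis : realSpace K → realSpace K`,
`expMapBasis x w = e^{x_{w₀}} ∏_{i ≠ w₀} |u_i|_w^{x_i}` (`expMapBasis_apply'`), comes with its
Jacobian (`abs_det_fderiv_expMapBasis`), the change-of-variables formula
`setLIntegral_expMapBasis_image` and the link `logMap_expMapBasis` to the fundamental cone; the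
identification below makes this machinery available for the Mellin unfolding (VII (5.5)). -/

open scoped Classical in
open NumberField.mixedEmbedding NumberField.mixedEmbedding.fundamentalCone
  NumberField.Units.dirichletUnitTheorem in
variable (K) in
/-- The parameters `X(c,t) ∈ ℝ^{places}` of Hecke's coordinates for Mathlib's `expMapBasis`:
`X(c,t)_{w₀} = (log t)/n` and `X(c,t)_w = 2 c_{i(w)}` for `w ≠ w₀` (`i = equivFinRank⁻¹`). [folklore] -/
def heckeParam (c : Fin (rank K) → ℝ) (t : ℝ) : realSpace K :=
  fun w ↦ if hw : w = w₀ then Real.log t / Module.finrank ℚ K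
    else 2 * c (equivFinRank.symm ⟨w, hw⟩)

open scoped Classical in
open NumberField.mixedEmbedding NumberField.mixedEmbedding.fundamentalCone
  NumberField.Units.dirichletUnitTheorem in
/-- **Hecke's coordinates are `expMapBasis ∘ X`**: `y(c,t) = expMapBasis (X(c,t))`. [folklore] -/
theorem expMapBasis_heckeParam (c : Fin (rank K) → ℝ) (t : ℝ) :
    expMapBasis (heckeParam K c t) = heckeCoord K c t := by
  funext w
  rw [expMapBasis_apply']
  simp only [Pi.smul_apply, smul_eq_mul, heckeParam, dif_pos, heckeCoord, heckeLogCoord,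
    Real.exp_add]
  congr 1
  -- reindex the product over `{w // w ≠ w₀}` by `Fin (rank K)` and turn powers into exponentials
  rw [← Equiv.prod_comp equivFinRank (fun i : {w // w ≠ w₀} ↦
      w (fundSystem K (equivFinRank.symm i) : K) ^
        (if hw : (i : InfinitePlace K) = w₀ then Real.log t / Module.finrank ℚ K
          else 2 * c (equivFinRank.symm ⟨i, hw⟩))),
    Finset.mul_sum, Real.exp_sum]
  refine Finset.prod_congr rfl fun j _ ↦ ?_
  rw [dif_neg (equivFinRank j).2, Subtype.coe_eta, Equiv.symm_apply_apply,
    Real.rpow_def_of_pos (pos_at_place _ w)]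
  congr 1
  ring

/-! ### Units of the fundamental system and the decomposition of `𝔞 ∖ 0` along the fundamental cone

Neukirch sums over a system `ℜ` of representatives of `𝔞^* / 𝒪^*` ((5.3), (5.4)) and unfolds the
unit action against the fundamental domain `F`. With Mathlib's fundamental cone
(`NumberField.mixedEmbedding.fundamentalCone`, a fundamental domain for `𝒪^*` modulo torsion) the
representatives are the cone points of `𝔞` (each class met `w` times), and every `a ∈ 𝔞 ∖ 0` is
uniquely `ε_m a'` with `a'` a cone point and `ε_m = ∏_i u_i^{m_i}`, `m ∈ ℤ^{r-1}`
(`coneDecompEquiv`). -/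

section ConeDecomposition

open NumberField.mixedEmbedding NumberField.mixedEmbedding.fundamentalCone

variable (K) in
/-- The unit `ε_m = ∏_i u_i^{m_i}` attached to an exponent vector `m ∈ ℤ^{r-1}`
(`u_i = fundSystem K i`). [folklore] -/
def fundUnit (m : Fin (rank K) → ℤ) : (𝓞 K)ˣ := ∏ i, fundSystem K i ^ m i

/-- `ε_0 = 1`. [folklore] -/
@[simp] theorem fundUnit_zero : fundUnit K 0 = 1 := by simp [fundUnit]

/-- `ε_{m+m'} = ε_m ε_{m'}`. [folklore] -/
theorem fundUnit_add (m m' : Fin (rank K) → ℤ) : fundUnit K (m + m') = fundUnit K m * fundUnit K m' := by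
  simp [fundUnit, zpow_add, Finset.prod_mul_distrib]

/-- `ε_{-m} = ε_m⁻¹`. [folklore] -/
theorem fundUnit_neg (m : Fin (rank K) → ℤ) : fundUnit K (-m) = (fundUnit K m)⁻¹ := by
  rw [eq_inv_iff_mul_eq_one, ← fundUnit_add, neg_add_cancel, fundUnit_zero]

/-- `ε_m` is a root of unity only for `m = 0` (uniqueness in Dirichlet's unit theorem, Mathlib
`Units.exist_unique_eq_mul_prod`). [folklore] -/
theorem fundUnit_mem_torsion_iff (m : Fin (rank K) → ℤ) : fundUnit K m ∈ torsion K ↔ m = 0 := by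
  refine ⟨fun h ↦ ?_, fun h ↦ by rw [h, fundUnit_zero]; exact one_mem _⟩
  have h1 : fundUnit K m = ((1, m) : torsion K × (Fin (rank K) → ℤ)).1 *
      ∏ i, fundSystem K i ^ ((1, m) : torsion K × (Fin (rank K) → ℤ)).2 i := by
    simp [fundUnit]
  have h2 : fundUnit K m = ((⟨fundUnit K m, h⟩, 0) : torsion K × (Fin (rank K) → ℤ)).1 *
      ∏ i, fundSystem K i ^ ((⟨fundUnit K m, h⟩, 0) : torsion K × (Fin (rank K) → ℤ)).2 i := by
    simp
  have := (exist_unique_eq_mul_prod K (fundUnit K m)).unique h1 h2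
  exact (Prod.ext_iff.mp this).2

omit [NumberField K] in
/-- `j(ε a) = ε • j(a)` for a unit `ε` (Mathlib's action `unitSMul` of `𝒪^*` on the Minkowski
space). [folklore] -/
theorem mixedEmbedding_unit_mul (u : (𝓞 K)ˣ) (a : K) :
    mixedEmbedding K ((u : K) * a) = u • mixedEmbedding K a := by
  rw [unitSMul_smul, map_mul]

/-- **Existence and uniqueness of the cone representative**: for `a ≠ 0` in `K` there is a unique
`m ∈ ℤ^{r-1}` with `j(ε_m a)` in the fundamental cone (Mathlib: `exists_unit_smul_mem`,
`unit_smul_mem_iff_mem_torsion`, `Units.exist_unique_eq_mul_prod`). [folklore] -/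
theorem existsUnique_fundUnit_mul_mem_fundamentalCone {a : K} (ha : a ≠ 0) :
    ∃! m : Fin (rank K) → ℤ, mixedEmbedding K ((fundUnit K m : K) * a) ∈ fundamentalCone K := by
  have hx : mixedEmbedding.norm (mixedEmbedding K a) ≠ 0 := by
    rw [norm_eq_norm, ne_eq, Rat.cast_eq_zero, abs_eq_zero, Algebra.norm_eq_zero_iff]
    exact ha
  obtain ⟨u, hu⟩ := exists_unit_smul_mem hx
  obtain ⟨⟨ζ, e⟩, hue, -⟩ := exist_unique_eq_mul_prod K u
  have hfe : fundUnit K e = (ζ : (𝓞 K)ˣ)⁻¹ * u := by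
    rw [eq_inv_mul_iff_mul_eq, hue]; rfl
  have he : mixedEmbedding K ((fundUnit K e : K) * a) ∈ fundamentalCone K := by
    rw [mixedEmbedding_unit_mul, hfe, mul_smul]
    exact torsion_smul_mem_of_mem hu (inv_mem ζ.2)
  refine ⟨e, he, fun m (hm : mixedEmbedding K ((fundUnit K m : K) * a) ∈ fundamentalCone K) ↦ ?_⟩
  rw [mixedEmbedding_unit_mul] at hm he
  have key : fundUnit K (m - e) • (fundUnit K e • mixedEmbedding K a) ∈ fundamentalCone K := by
    rwa [← mul_smul, ← fundUnit_add, sub_add_cancel]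
  have := (unit_smul_mem_iff_mem_torsion he _).mp key
  rwa [fundUnit_mem_torsion_iff, sub_eq_zero] at this

/-- The **cone exponent** of `a ≠ 0`: the `m` with `j(ε_m a)` in the fundamental cone. [folklore] -/
def coneExponent (a : K) (ha : a ≠ 0) : Fin (rank K) → ℤ :=
  (existsUnique_fundUnit_mul_mem_fundamentalCone ha).choose

/-- `j(ε_{m(a)} a)` lies in the fundamental cone for the cone exponent `m(a)`. [folklore] -/
theorem coneExponent_spec (a : K) (ha : a ≠ 0) :
    mixedEmbedding K ((fundUnit K (coneExponent a ha) : K) * a) ∈ fundamentalCone K :=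
  (existsUnique_fundUnit_mul_mem_fundamentalCone ha).choose_spec.1

/-- Uniqueness of the cone exponent. [folklore] -/
theorem coneExponent_eq {a : K} (ha : a ≠ 0) {m : Fin (rank K) → ℤ}
    (hm : mixedEmbedding K ((fundUnit K m : K) * a) ∈ fundamentalCone K) : coneExponent a ha = m :=
  ((existsUnique_fundUnit_mul_mem_fundamentalCone ha).unique (coneExponent_spec a ha) hm)

variable (K) in
/-- The **cone points** of a fractional ideal `𝔞`: elements `a ∈ 𝔞` with `j(a)` in Mathlib's
fundamental cone (then `a ≠ 0`); a set of representatives of `𝔞^*/𝒪^*` counted `w` times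
(Neukirch VII (5.3), via `unit_smul_mem_iff_mem_torsion`). [folklore] -/
def conePoints (I : FractionalIdeal (𝓞 K)⁰ K) : Set K :=
  {a | a ∈ I ∧ mixedEmbedding K a ∈ fundamentalCone K}

/-- Cone points are nonzero. [folklore] -/
theorem ne_zero_of_mem_conePoints {I : FractionalIdeal (𝓞 K)⁰ K} {a : K} (ha : a ∈ conePoints K I) :
    a ≠ 0 := by
  rintro rfl
  exact (norm_pos_of_mem ha.2).ne' (by simp)

omit [NumberField K] in
/-- A unit multiple of an element of `𝔞` lies in `𝔞`. [folklore] -/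
theorem unit_mul_mem {I : FractionalIdeal (𝓞 K)⁰ K} (u : (𝓞 K)ˣ) {a : K} (ha : a ∈ I) :
    (u : K) * a ∈ I := by
  have := (I : Submodule (𝓞 K) K).smul_mem ((u : (𝓞 K)ˣ) : 𝓞 K) ha
  rwa [Algebra.smul_def] at this

/-- `ε_{-m} (ε_m a) = a`. [folklore] -/
theorem fundUnit_neg_mul_fundUnit_mul (m : Fin (rank K) → ℤ) (a : K) :
    (fundUnit K (-m) : K) * ((fundUnit K m : K) * a) = a := by
  rw [← mul_assoc, ← coe_mul, ← fundUnit_add, neg_add_cancel, fundUnit_zero, coe_one, one_mul]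

variable (K) in
/-- **Decomposition of `𝔞 ∖ 0` along the fundamental cone**: `a ↦ (a', m)` with `a = ε_m a'`,
`a' = ε_{-m} a` the cone representative of `a` (`existsUnique_fundUnit_mul_mem_fundamentalCone`).
This is the bijection `𝔞^* ≅ (cone points) × ℤ^{r-1}` used to unfold `∑_{a ∈ 𝔞^*} ∫_F` into
`∑_{a'} ∫_{ℝ^{r-1}}` in the proof of Neukirch VII (5.5). [folklore] -/
def coneDecompEquiv (I : FractionalIdeal (𝓞 K)⁰ K) :
    {a : K // a ∈ I ∧ a ≠ 0} ≃ conePoints K I × (Fin (rank K) → ℤ) where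
  toFun a := (⟨(fundUnit K (coneExponent a.1 a.2.2) : K) * a, unit_mul_mem _ a.2.1,
      coneExponent_spec a.1 a.2.2⟩, -coneExponent a.1 a.2.2)
  invFun p := ⟨(fundUnit K p.2 : K) * p.1, unit_mul_mem _ p.1.2.1,
    mul_ne_zero (coe_ne_zero _) (ne_zero_of_mem_conePoints p.1.2)⟩
  left_inv a := Subtype.ext (fundUnit_neg_mul_fundUnit_mul _ _)
  right_inv p := by
    obtain ⟨⟨a', ha'⟩, m'⟩ := p
    have hne : (fundUnit K m' : K) * a' ≠ 0 :=
      mul_ne_zero (coe_ne_zero _) (ne_zero_of_mem_conePoints ha')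
    -- the cone exponent of `ε_{m'} a'` is `-m'`
    have hm : coneExponent ((fundUnit K m' : K) * a') hne = -m' := by
      refine coneExponent_eq hne ?_
      rw [fundUnit_neg_mul_fundUnit_mul]
      exact ha'.2
    refine Prod.ext (Subtype.ext ?_) ?_
    · show (fundUnit K (coneExponent ((fundUnit K m' : K) * a') hne) : K) * ((fundUnit K m' : K) * a')
        = a'
      rw [hm, fundUnit_neg_mul_fundUnit_mul]
    · show -coneExponent ((fundUnit K m' : K) * a') hne = m'
      rw [hm, neg_neg]

/-- Inverse of `coneDecompEquiv`: `(a', m) ↦ ε_m a'`. [folklore] -/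
theorem coneDecompEquiv_symm_apply (I : FractionalIdeal (𝓞 K)⁰ K)
    (p : conePoints K I × (Fin (rank K) → ℤ)) :
    ((coneDecompEquiv K I).symm p : K) = (fundUnit K p.2 : K) * p.1 := rfl

end ConeDecomposition

/-! ### Continuity of the theta series in `y > 0` -/

/-- Each summand `y ↦ e^{-π⟨ay,a⟩}` is continuous in `y`. [folklore] -/
theorem continuous_thetaSummand (a : K) : Continuous fun y : InfinitePlace K → ℝ ↦ thetaSummand K y a := by
  unfold thetaSummand minkowskiQuadForm
  fun_prop

/-- The theta series `y ↦ θ_𝔞(iy)` is continuous on `{y | y ≥ δ}` for every `δ > 0`: uniform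
convergence by comparison with the summable series at `y = δ·1` (Neukirch VII (3.5):
"converges absolutely and uniformly on every compact subset"). [cite: NeukirchANT1999, Ch. VII (3.5)] -/
theorem continuousOn_thetaIdeal_of_le (I : FractionalIdeal (𝓞 K)⁰ K) {δ : ℝ} (hδ : 0 < δ) :
    ContinuousOn (thetaIdeal K I) {y | ∀ w, δ ≤ y w} := by
  refine continuousOn_tsum (fun a ↦ (continuous_thetaSummand (a : K)).continuousOn)
    (summable_thetaIdeal_holds K I (fun _ ↦ δ) fun _ ↦ hδ) fun a y hy ↦ ?_
  rw [Real.norm_of_nonneg (thetaSummand_pos y _).le, thetaSummand_eq_mixedGaussian,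
    thetaSummand_eq_mixedGaussian]
  exact mixedGaussian_le_mixedGaussian K hy _

/-- The theta series is continuous at every `y > 0`. [folklore] -/
theorem continuousAt_thetaIdeal (I : FractionalIdeal (𝓞 K)⁰ K) {y : InfinitePlace K → ℝ}
    (hy : ∀ w, 0 < y w) : ContinuousAt (thetaIdeal K I) y := by
  obtain ⟨w₀, -, hw₀⟩ := Finset.exists_min_image Finset.univ y Finset.univ_nonempty
  have hδ : 0 < y w₀ / 2 := half_pos (hy w₀)
  refine (continuousOn_thetaIdeal_of_le I hδ).continuousAt ?_
  refine Filter.mem_of_superset ((isOpen_set_pi Set.finite_univ fun w _ ↦ isOpen_Ioi (a := y w₀ / 2))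
    |>.mem_nhds fun w _ ↦ ?_) fun z hz w ↦ (hz w (Set.mem_univ w)).le
  exact (half_lt_self (hy w₀)).trans_le (hw₀ w (Finset.mem_univ w))

/-- `c ↦ y(εc, t)` is continuous. [folklore] -/
theorem continuous_heckeCoord_smul (ε t : ℝ) :
    Continuous fun c : Fin (rank K) → ℝ ↦ heckeCoord K (ε • c) t := by
  unfold heckeCoord heckeLogCoord
  fun_prop

/-- `t ↦ y(c, t)` is continuous at every `t ≠ 0`. [folklore] -/
theorem continuousAt_heckeCoord (c : Fin (rank K) → ℝ) {t : ℝ} (ht : t ≠ 0) :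
    ContinuousAt (fun t : ℝ ↦ heckeCoord K c t) t := by
  refine continuousAt_pi.mpr fun w ↦ ?_
  unfold heckeCoord heckeLogCoord
  exact ((((Real.continuousAt_log ht).div_const _).add continuousAt_const).rexp)

/-- `c ↦ θ_𝔞(i y(εc,t))` is continuous for fixed `t`. [folklore] -/
theorem continuous_thetaIdeal_heckeCoord (I : FractionalIdeal (𝓞 K)⁰ K) (ε t : ℝ) :
    Continuous fun c : Fin (rank K) → ℝ ↦ thetaIdeal K I (heckeCoord K (ε • c) t) := by
  refine continuous_iff_continuousAt.mpr fun c ↦ ?_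
  exact (continuousAt_thetaIdeal I (heckeCoord_pos (ε • c) t)).comp
    (f := fun c : Fin (rank K) → ℝ ↦ heckeCoord K (ε • c) t) (continuous_heckeCoord_smul ε t).continuousAt

/-- `y(c, t)` is monotone in `t > 0` coordinatewise. [folklore] -/
theorem heckeCoord_mono (c : Fin (rank K) → ℝ) {t t' : ℝ} (ht : 0 < t) (h : t ≤ t')
    (w : InfinitePlace K) : heckeCoord K c t w ≤ heckeCoord K c t' w := by
  unfold heckeCoord heckeLogCoord
  have : (0 : ℝ) < Module.finrank ℚ K := Nat.cast_pos.mpr Module.finrank_pos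
  gcongr

/-! ### The one-variable theta integrals `f(t)`, `g(t)` of Neukirch VII (5.5), (5.8) in Hecke's coordinates -/

variable (K) in
/-- `f_{𝔞,ε}(t) = ∫_{c ∈ [0,1]^{r-1}} θ_𝔞(i y(εc,t)) dc` (`ε = 1`: Neukirch's `f_F(𝔞, ·)`; `ε = -1`: his
`f_{F⁻¹}(𝔞, ·)`, VII (5.5), (5.8)), for `F` the image of the unit cube under Hecke's coordinates,
without the normalisations `w⁻¹`, `d*x` (we integrate against Lebesgue measure `dc`) and
`t ↦ t/d_𝔞`; these only change `f` by explicit constants, recorded in the Mellin identity.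
[folklore] -/
def heckeFi (I : FractionalIdeal (𝓞 K)⁰ K) (ε t : ℝ) : ℝ :=
  ∫ c in Set.Icc (0 : Fin (rank K) → ℝ) 1, thetaIdeal K I (heckeCoord K (ε • c) t)

/-- The unit cube `[0,1]^{r-1}` has Lebesgue measure `1`. [folklore] -/
theorem volume_real_unitCube : (volume (Set.Icc (0 : Fin (rank K) → ℝ) 1)).toReal = 1 := by
  rw [Real.volume_Icc_pi_toReal zero_le_one]
  simp

/-- The unit cube has finite measure. [folklore] -/
theorem volume_unitCube_lt_top : volume (Set.Icc (0 : Fin (rank K) → ℝ) 1) < ⊤ := by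
  simp [Real.volume_Icc_pi]

/-- `∫_{[0,1]^{r-1}} C dc = C`. [folklore] -/
theorem setIntegral_unitCube_const (C : ℝ) : ∫ _ in Set.Icc (0 : Fin (rank K) → ℝ) 1, C = C := by
  rw [setIntegral_const, smul_eq_mul, Measure.real, volume_real_unitCube, one_mul]

/-- `c ↦ θ_𝔞(i y(εc,t))` is integrable on the unit cube (continuous on a compact set). [folklore] -/
theorem integrableOn_thetaIdeal_heckeCoord (I : FractionalIdeal (𝓞 K)⁰ K) (ε t : ℝ) :
    IntegrableOn (fun c : Fin (rank K) → ℝ ↦ thetaIdeal K I (heckeCoord K (ε • c) t))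
      (Set.Icc (0 : Fin (rank K) → ℝ) 1) :=
  (continuous_thetaIdeal_heckeCoord I ε t).continuousOn.integrableOn_compact isCompact_Icc

/-- `f_{𝔞,ε}(t) ≥ 1` (from `θ ≥ 1` and `vol [0,1]^{r-1} = 1`). [folklore] -/
theorem one_le_heckeFi (I : FractionalIdeal (𝓞 K)⁰ K) (ε t : ℝ) : 1 ≤ heckeFi K I ε t := by
  rw [heckeFi, ← setIntegral_unitCube_const (K := K) 1]
  refine setIntegral_mono_on (integrableOn_const volume_unitCube_lt_top.ne)
    (integrableOn_thetaIdeal_heckeCoord I ε t) measurableSet_Icc fun c _ ↦ ?_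
  exact one_le_thetaIdeal K I (heckeCoord_pos (ε • c) t)

/-- `f_{𝔞,ε}` is antitone on `t > 0`. [folklore] -/
theorem heckeFi_antitoneOn (I : FractionalIdeal (𝓞 K)⁰ K) (ε : ℝ) :
    AntitoneOn (heckeFi K I ε) (Set.Ioi 0) := by
  intro t ht t' _ htt'
  refine setIntegral_mono_on (integrableOn_thetaIdeal_heckeCoord I ε t')
    (integrableOn_thetaIdeal_heckeCoord I ε t) measurableSet_Icc fun c _ ↦ ?_
  exact thetaIdeal_le_thetaIdeal K I (fun w ↦ heckeCoord_pos _ _ w)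
    (fun w ↦ heckeCoord_mono (ε • c) ht htt' w)

/-- `f_{𝔞,ε}` is continuous on `t > 0` (dominated convergence: near `t₀` the integrand is bounded
by its value at `t₀/2`). [folklore] -/
theorem continuousOn_heckeFi (I : FractionalIdeal (𝓞 K)⁰ K) (ε : ℝ) :
    ContinuousOn (heckeFi K I ε) (Set.Ioi 0) := by
  intro t₀ ht₀
  refine ContinuousAt.continuousWithinAt ?_
  have h2 : 0 < t₀ / 2 := half_pos ht₀
  have hmem : Set.Ioi (t₀ / 2) ∈ nhds t₀ := isOpen_Ioi.mem_nhds (Set.mem_Ioi.mpr (half_lt_self ht₀))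
  refine continuousAt_of_dominated (μ := volume.restrict (Set.Icc (0 : Fin (rank K) → ℝ) 1))
    (bound := fun c ↦ thetaIdeal K I (heckeCoord K (ε • c) (t₀ / 2))) ?_ ?_ ?_ ?_
  · exact Filter.Eventually.of_forall fun t ↦
      (continuous_thetaIdeal_heckeCoord I ε t).aestronglyMeasurable
  · filter_upwards [hmem] with t (ht : t₀ / 2 < t)
    refine Filter.Eventually.of_forall fun c ↦ ?_
    rw [Real.norm_of_nonneg (thetaIdeal_nonneg _ _)]
    exact thetaIdeal_le_thetaIdeal K I (fun w ↦ heckeCoord_pos _ _ w)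
      (fun w ↦ heckeCoord_mono (ε • c) h2 ht.le w)
  · exact integrableOn_thetaIdeal_heckeCoord I ε (t₀ / 2)
  · refine Filter.Eventually.of_forall fun c ↦ ?_
    exact (continuousAt_thetaIdeal I (heckeCoord_pos (ε • c) t₀)).comp
      (f := fun t : ℝ ↦ heckeCoord K (ε • c) t) (continuousAt_heckeCoord _ ht₀.ne')

/-- `f_{𝔞,ε}` is locally integrable on `(0, ∞)` (hypothesis `hf_int` of Mathlib's `WeakFEPair`).
[folklore] -/
theorem locallyIntegrableOn_heckeFi (I : FractionalIdeal (𝓞 K)⁰ K) (ε : ℝ) :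
    LocallyIntegrableOn (heckeFi K I ε) (Set.Ioi 0) :=
  (continuousOn_heckeFi I ε).locallyIntegrableOn measurableSet_Ioi

/-! ### Lower bound for Hecke's coordinates on the unit cube and decay of `f - 1` -/

variable (K) in
/-- `M = ∑_i ∑_w |log |u_i|_w|`, a bound for the unit-lattice part of Hecke's coordinates on the
unit cube. [folklore] -/
def unitLogBound : ℝ :=
  ∑ i : Fin (rank K), ∑ w : InfinitePlace K, |Real.log (w (fundSystem K i : K))|

/-- `M ≥ 0`. [folklore] -/
theorem unitLogBound_nonneg : 0 ≤ unitLogBound K :=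
  Finset.sum_nonneg fun _ _ ↦ Finset.sum_nonneg fun _ _ ↦ abs_nonneg _

/-- On the cube `|c_i| ≤ 1`: `(log t)/n - 2M ≤ u(c,t)_w`. [folklore] -/
theorem heckeLogCoord_ge {c : Fin (rank K) → ℝ} (hc : ∀ i, |c i| ≤ 1) (t : ℝ) (w : InfinitePlace K) :
    Real.log t / Module.finrank ℚ K - 2 * unitLogBound K ≤ heckeLogCoord K c t w := by
  rw [heckeLogCoord, sub_eq_add_neg, ← mul_neg]
  gcongr
  rw [neg_le, ← Finset.sum_neg_distrib]
  refine (Finset.sum_le_sum fun i _ ↦ ?_)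
  calc -(c i * Real.log (w (fundSystem K i : K))) ≤ |c i * Real.log (w (fundSystem K i : K))| :=
        neg_le_abs _
    _ = |c i| * |Real.log (w (fundSystem K i : K))| := abs_mul _ _
    _ ≤ 1 * |Real.log (w (fundSystem K i : K))| := by gcongr; exact hc i
    _ ≤ ∑ w' : InfinitePlace K, |Real.log (w' (fundSystem K i : K))| := by
        rw [one_mul]
        exact Finset.single_le_sum (f := fun w' : InfinitePlace K ↦
          |Real.log (w' (fundSystem K i : K))|) (fun _ _ ↦ abs_nonneg _) (Finset.mem_univ w)

/-- On the cube: `e^{-2M} t^{1/n} ≤ y(c,t)_w` for `t > 0`. [folklore] -/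
theorem heckeCoord_ge {c : Fin (rank K) → ℝ} (hc : ∀ i, |c i| ≤ 1) {t : ℝ} (ht : 0 < t)
    (w : InfinitePlace K) :
    Real.exp (-2 * unitLogBound K) * t ^ (1 / (Module.finrank ℚ K : ℝ)) ≤ heckeCoord K c t w := by
  rw [heckeCoord, Real.rpow_def_of_pos ht, ← Real.exp_add]
  refine Real.exp_le_exp.mpr ?_
  have := heckeLogCoord_ge hc t w
  rw [one_div, ← div_eq_mul_inv]
  linarith

/-- Points of the signed unit cube have coordinates of absolute value `≤ 1`. [folklore] -/
theorem abs_smul_le_one_of_mem_Icc {ε : ℝ} (hε : |ε| ≤ 1) {c : Fin (rank K) → ℝ}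
    (hc : c ∈ Set.Icc (0 : Fin (rank K) → ℝ) 1) (i : Fin (rank K)) : |(ε • c) i| ≤ 1 := by
  rw [Pi.smul_apply, smul_eq_mul, abs_mul]
  have h0 : 0 ≤ c i := hc.1 i
  have h1 : c i ≤ 1 := hc.2 i
  rw [abs_of_nonneg h0]
  nlinarith [abs_nonneg ε]

/-- **Decay of `f - 1`** (polynomial form of Neukirch VII (5.8), `f_F(𝔞,t) = a₀ + O(e^{-ct^{1/n}})`):
for `2k > n` there is `C` with `f_{𝔞,ε}(t) - 1 ≤ C t^{-k/n}` for `t ≥ 1` (`|ε| ≤ 1`). [folklore] -/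
theorem heckeFi_sub_one_le (I : FractionalIdeal (𝓞 K)⁰ K) (hI : I ≠ 0) {ε : ℝ} (hε : |ε| ≤ 1)
    {k : ℕ} (hk : Module.finrank ℚ K < 2 * k) :
    ∃ C : ℝ, ∀ t : ℝ, 1 ≤ t →
      heckeFi K I ε t - 1 ≤ C * t ^ (-(k : ℝ) / Module.finrank ℚ K) := by
  obtain ⟨C, hC⟩ := thetaIdeal_sub_one_le K I hI hk
  refine ⟨C * Real.exp (2 * unitLogBound K) ^ k, fun t ht ↦ ?_⟩
  have ht0 : 0 < t := one_pos.trans_le ht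
  set δ : ℝ := Real.exp (-2 * unitLogBound K) * t ^ (1 / (Module.finrank ℚ K : ℝ)) with hδ
  have hδpos : 0 < δ := mul_pos (Real.exp_pos _) (Real.rpow_pos_of_pos ht0 _)
  have hpt : ∀ c ∈ Set.Icc (0 : Fin (rank K) → ℝ) 1,
      thetaIdeal K I (heckeCoord K (ε • c) t) - 1 ≤ C * δ⁻¹ ^ k := fun c hc ↦
    hC δ hδpos _ fun w ↦ heckeCoord_ge (abs_smul_le_one_of_mem_Icc hε hc) ht0 w
  have hδk : δ⁻¹ ^ k = Real.exp (2 * unitLogBound K) ^ k * t ^ (-(k : ℝ) / Module.finrank ℚ K) := by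
    rw [hδ, mul_inv, mul_pow, ← Real.exp_neg, neg_mul, neg_neg, ← Real.rpow_neg ht0.le,
      ← Real.rpow_natCast (t ^ (-(1 / (Module.finrank ℚ K : ℝ)))), ← Real.rpow_mul ht0.le]
    congr 2
    field_simp
  calc heckeFi K I ε t - 1
      = ∫ c in Set.Icc (0 : Fin (rank K) → ℝ) 1, (thetaIdeal K I (heckeCoord K (ε • c) t) - 1) := by
        rw [integral_sub (integrableOn_thetaIdeal_heckeCoord I ε t)
          (integrableOn_const volume_unitCube_lt_top.ne), setIntegral_unitCube_const, heckeFi]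
    _ ≤ ∫ _ in Set.Icc (0 : Fin (rank K) → ℝ) 1, C * δ⁻¹ ^ k :=
        setIntegral_mono_on ((integrableOn_thetaIdeal_heckeCoord I ε t).sub
          (integrableOn_const volume_unitCube_lt_top.ne))
          (integrableOn_const volume_unitCube_lt_top.ne) measurableSet_Icc hpt
    _ = C * Real.exp (2 * unitLogBound K) ^ k * t ^ (-(k : ℝ) / Module.finrank ℚ K) := by
        rw [setIntegral_unitCube_const, hδk, mul_assoc]

/-- `f_{𝔞,ε}(t) - 1 = O(t^r)` at `∞` for every real `r` (hypothesis `hf_top` of Mathlib's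
`WeakFEPair`; from `heckeFi_sub_one_le` with `k ≥ -rn`). [folklore] -/
theorem isBigO_heckeFi_sub_one (I : FractionalIdeal (𝓞 K)⁰ K) (hI : I ≠ 0) {ε : ℝ} (hε : |ε| ≤ 1)
    (r : ℝ) :
    (fun t ↦ ((heckeFi K I ε t : ℝ) : ℂ) - 1) =O[Filter.atTop] fun t ↦ t ^ r := by
  -- choose `k` with `2k > n` and `-k/n ≤ r`
  obtain ⟨k, hk, hkr⟩ : ∃ k : ℕ, Module.finrank ℚ K < 2 * k ∧
      -(k : ℝ) / Module.finrank ℚ K ≤ r := by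
    obtain ⟨k, hk⟩ := exists_nat_gt (max (Module.finrank ℚ K : ℝ) (-r * Module.finrank ℚ K))
    have hn : (0 : ℝ) < Module.finrank ℚ K := Nat.cast_pos.mpr Module.finrank_pos
    refine ⟨k, ?_, ?_⟩
    · have : (Module.finrank ℚ K : ℝ) < k := (le_max_left _ _).trans_lt hk
      exact_mod_cast (show (Module.finrank ℚ K : ℝ) < 2 * k by linarith)
    · have : -r * Module.finrank ℚ K < k := (le_max_right _ _).trans_lt hk
      rw [div_le_iff₀ hn]
      linarith
  obtain ⟨C, hC⟩ := heckeFi_sub_one_le I hI hε hk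
  refine Asymptotics.IsBigO.of_bound |C| ?_
  filter_upwards [Filter.eventually_ge_atTop (1 : ℝ)] with t ht
  have ht0 : 0 < t := one_pos.trans_le ht
  have h0 : 0 ≤ heckeFi K I ε t - 1 := sub_nonneg.mpr (one_le_heckeFi I ε t)
  rw [← Complex.ofReal_one, ← Complex.ofReal_sub, Complex.norm_real, Real.norm_of_nonneg h0,
    Real.norm_of_nonneg (Real.rpow_nonneg ht0.le r)]
  calc heckeFi K I ε t - 1 ≤ C * t ^ (-(k : ℝ) / Module.finrank ℚ K) := hC t ht
    _ ≤ |C| * t ^ (-(k : ℝ) / Module.finrank ℚ K) :=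
        mul_le_mul_of_nonneg_right (le_abs_self C) (Real.rpow_nonneg ht0.le _)
    _ ≤ |C| * t ^ r :=
        mul_le_mul_of_nonneg_left (Real.rpow_le_rpow_of_exponent_le ht hkr) (abs_nonneg C)

/-! ### The functional equation `f(1/t) = ε t^{1/2} g(t)` from the theta transformation formula -/

/-- **`f_{𝔞,ε}(1/t) = t^{1/2} / (𝔑(𝔞)√|d_K|) · f_{(𝔞𝔡)⁻¹,-ε}(t)`** — the first formula of Neukirch
VII (5.8), `f_F(𝔞, 1/t) = t^{1/2} f_{F⁻¹}((𝔞𝔡)⁻¹, t)`, in Hecke's coordinates (the constant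
`(𝔑(𝔞)√|d_K|)⁻¹` appears because we do not rescale `t` by `d_𝔞`), from the theta transformation
formula `thetaIdeal_inv` (VII (3.6) with (5.7)), `y(c, 1/t) = y(-c, t)⁻¹` and `N(y(-c,t)) = t`.
[cite: NeukirchANT1999, Ch. VII (5.8)] -/
theorem heckeFi_inv (hinv : thetaIdeal_inv K) (I : FractionalIdeal (𝓞 K)⁰ K) (hI : I ≠ 0)
    (ε : ℝ) {t : ℝ} (ht : 0 < t) :
    heckeFi K I ε t⁻¹ = Real.sqrt t / ((FractionalIdeal.absNorm I : ℝ) * Real.sqrt |(discr K : ℝ)|)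
      * heckeFi K (FractionalIdeal.dual ℤ ℚ I) (-ε) t := by
  rw [heckeFi, heckeFi, ← integral_const_mul]
  refine setIntegral_congr_fun measurableSet_Icc fun c _ ↦ ?_
  rw [heckeCoord_inv, hinv I hI _ (fun w ↦ heckeCoord_pos _ t w), mixedNorm_heckeCoord _ ht,
    neg_smul]

/-- `𝔑(𝔞) √|d_K| ≠ 0` for a nonzero fractional ideal. [folklore] -/
theorem absNorm_mul_sqrt_discr_ne_zero (I : FractionalIdeal (𝓞 K)⁰ K) (hI : I ≠ 0) :
    (FractionalIdeal.absNorm I : ℝ) * Real.sqrt |(discr K : ℝ)| ≠ 0 := by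
  refine mul_ne_zero ?_ (Real.sqrt_ne_zero'.mpr (abs_pos.mpr (Int.cast_ne_zero.mpr (discr_ne_zero K))))
  exact_mod_cast (FractionalIdeal.absNorm_eq_zero_iff.not.mpr hI)

variable (K) in
/-- **The weak FE-pair of a nonzero fractional ideal** (Neukirch VII (5.8) ⇒ hypotheses of the
Mellin principle (1.4), here Mathlib's `WeakFEPair`): `f = f_{𝔞,1}`, `g = f_{(𝔞𝔡)⁻¹,-1}`, weight
`k = 1/2`, constant `ε = (𝔑(𝔞)√|d_K|)⁻¹`, constant terms `f₀ = g₀ = 1`; conditional on the theta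
transformation formula `thetaIdeal_inv`. [cite: NeukirchANT1999, Ch. VII (5.8), (5.9)] -/
def heckePair (hinv : thetaIdeal_inv K) (I : FractionalIdeal (𝓞 K)⁰ K) (hI : I ≠ 0) :
    WeakFEPair ℂ where
  f := fun t ↦ ((heckeFi K I 1 t : ℝ) : ℂ)
  g := fun t ↦ ((heckeFi K (FractionalIdeal.dual ℤ ℚ I) (-1) t : ℝ) : ℂ)
  k := 1 / 2
  ε := ((((FractionalIdeal.absNorm I : ℝ) * Real.sqrt |(discr K : ℝ)|)⁻¹ : ℝ) : ℂ)
  f₀ := 1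
  g₀ := 1
  hf_int := (Complex.continuous_ofReal.comp_continuousOn (continuousOn_heckeFi I 1)
    ).locallyIntegrableOn measurableSet_Ioi
  hg_int := (Complex.continuous_ofReal.comp_continuousOn (continuousOn_heckeFi _ (-1))
    ).locallyIntegrableOn measurableSet_Ioi
  hk := one_half_pos
  hε := by exact_mod_cast inv_ne_zero (absNorm_mul_sqrt_discr_ne_zero I hI)
  h_feq := fun x hx ↦ by
    have hx0 : 0 < x := hx
    simp only [one_div]
    rw [heckeFi_inv hinv I hI 1 hx0, smul_eq_mul, Real.sqrt_eq_rpow, Complex.ofReal_mul,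
      Complex.ofReal_div, Complex.ofReal_inv, div_eq_mul_inv, Complex.ofReal_mul]
    ring
  hf_top := fun r ↦ isBigO_heckeFi_sub_one I hI (by simp) r
  hg_top := fun r ↦ isBigO_heckeFi_sub_one _ (FractionalIdeal.dual_ne_zero ℤ ℚ hI) (by simp) r

end Literature.NumberTheory.LFunctions.NumberField
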